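import Literature.NumberTheory.Rogawski1990.ArchCentralValueTransferCongruence  -- ★ p841588: the letter along an abstract arch congruence
import Literature.NumberTheory.Automorphic.ArchCongruenceTransport             -- ★ the rational congruence iso + guard transport (T-d)(a)+(e)
import Literature.NumberTheory.QuadraticForms.FiniteFieldHermitianCanonicalForm  -- ★ `Hermitian.exists_congr_diagonal_of_involution`
import HarnessLib

/-!
# (S-d) on the canonical frames from (S-d) on DIAGONAL forms — the R5 pay-down of record for `stub_SdCanonical` (ROAD-Sd, line `F0_P3a_SdArch`)
(Rogawski (1990), §14.5 p. 239, §14.1 p. 232, §1.7 p. 6; Landherr; Platonov–Rapinchuk §2.3)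

Topic `NumberTheory/Rogawski1990`; namespace `Literature.NumberTheory.Rogawski1990`.  THEOREMS ONLY (no definition, no instance, no notation, no named fact,
no `sorry`).  Cell `hodgecm-mathlib`, crux H413 (`stmt-HodgeConjecture-24833`); LEAD F0P3a-plan (g9) WORD T8-85 (1) («the R5 pay-down of record; fixes R4's frame to
`arch (diagonal α)`»); F0P3-p03 (g9).  Count-neutral floor-1 plumbing under books row #111; HC_CM is proved only modulo the printed citations until rung 0 closes.

THE STATEMENT.  `archCentralValueTransferExists_canonical_of_diagonal`: IF the (S-d) letter ★ `ArchCentralValueTransferExists` holds — in the EXACT shape of the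
registered stub `stub_SdCanonical` (tree `Cruxes/H413/Lines/F0_P3a_SdArch.lean` :195, its four guards `hherm`, `hanis`, `hS₀`, `IsArchNondegenerate`) — for every
DIAGONAL hermitian form `H₂ = diagonal α`, THEN it holds for every form `H′` (the stub's statement VERBATIM).  PROOF: diagonalise `H′` over `L` by a rational
frame `P` (★ `QuadraticForms.Hermitian.exists_congr_diagonal_of_involution`: `ᵗ(c̄P) H′ P = diagonal α`, `det H′ ≠ 0` by anisotropy ★ `Godement.det_ne_zero_of_anisotropic`);
the arch congruence `Φ = Ψ_P⁻¹ : U(H′)(L ⊗ ℝ) ≃ₜ* U(ᵗc̄P H′ P)(L ⊗ ℝ)` (★ `unitaryGroupOfFormCongrOfEq`, action ★ `coe_archCongr_symm_apply`) is an abstract frame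
`(S, Φ, hΦ)` with `S = (P ⊗ 1)⁻¹`; the guards transport (★ `transpose_map_formCongr_cm`, ★ `anisotropic_formCongr_cm`, ★ `exists_posDef_formCongr_cm`, and ★ FILE 5
`isArchNondegenerate_comap_iff` with the factor round trip ★ `TransferFactorData.comap_symm_comap`); then ONE application of ★ `archCentralValueTransferExists_of_archCongr`
(p841588) with `νt := Φ_* ν′`.  The line's junction is `stub_SdCanonical := archCentralValueTransferExists_canonical_of_diagonal stub_SdDiagonal` for a stub
`stub_SdDiagonal` of the hypothesis' shape (R4's pen works on `arch (diagonal α)` only).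

## References
* [Rogawski1990] J. D. Rogawski, *Automorphic Representations of Unitary Groups in Three Variables*, Ann. of Math. Stud. 123 (1990), §14.5 p. 239, §14.1 p. 232, §1.7 p. 6.
* [PlatonovRapinchuk1994] V. Platonov, A. Rapinchuk, *Algebraic Groups and Number Theory* (1994), §2.3.
* [Landherr1936HermitianForms] W. Landherr, *Äquivalenz Hermitescher Formen über einem beliebigen algebraischen Zahlkörper* (1936) (diagonalisation of hermitian forms).
-/

set_option autoImplicit false

noncomputable section

open MeasureTheory Measure NumberField NumberField.InfinitePlace NumberField.mixedEmbedding IsDedekindDomain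
open Literature.MeasureTheory.Group

namespace Literature.NumberTheory.Rogawski1990

open Literature.NumberTheory.Automorphic Literature.NumberTheory.GaloisRepresentations
open Literature.AlgebraicGeometry.ShimuraVarieties (unitaryGroup hermForm)
open scoped Matrix ComplexOrder MatrixGroups

/-- **A RATIONAL DIAGONALISING FRAME**: a `c`-hermitian anisotropic `H′ ∈ M₃(L)` is congruent over `L` to a diagonal form — `ᵗ(c̄P) H′ P = diagonal α` for some
`P ∈ GL₃(L)` (★ `Hermitian.exists_congr_diagonal_of_involution`; `det H′ ≠ 0` from anisotropy). [cite: Landherr1936HermitianForms] [cite: PlatonovRapinchuk1994, §2.3] -/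
theorem exists_formCongr_eq_diagonal (L : Type) [Field L] [NumberField L] [IsCMField L] (H' : Matrix (Fin 3) (Fin 3) L)
    (hherm : (H'.map (cmConjRingHom L)).transpose = H') (hanis : ∀ x : Fin 3 → L, hermForm (cmConjRingHom L) H' x x = 0 → x = 0) :
    ∃ (P : GL (Fin 3) L) (α : Fin 3 → L), formCongr (cmConjRingHom L) P H' = Matrix.diagonal α := by
  have hdet : H'.det ≠ 0 := Godement.det_ne_zero_of_anisotropic L H' hanis
  have hherm' : (Matrix.transpose H').map (cmConjRingHom L) = H' := by rw [Matrix.transpose_map]; exact hherm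
  obtain ⟨P₀, hP₀, α, -, -, hdiag⟩ := QuadraticForms.Hermitian.exists_congr_diagonal_of_involution (σ := cmConjRingHom L)
    (IsCMField.complexConj_apply_apply L) ⟨1, by rw [map_one]; norm_num⟩ H' hherm' hdet
  refine ⟨Matrix.GeneralLinearGroup.mkOfDetNeZero P₀ hP₀.ne_zero, α, ?_⟩
  rw [← hdiag, formCongr, Matrix.transpose_map]
  rfl

/-- **(S-d) ON THE CANONICAL FRAMES FROM (S-d) ON DIAGONAL FORMS** — the R5 pay-down of record: if the letter (in the exact shape of the registered stub
`stub_SdCanonical`, four guards) holds for every DIAGONAL `H₂`, it holds for every `H′` (statement = the stub VERBATIM).  Rational diagonalising frame + guard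
transport + ★ `archCentralValueTransferExists_of_archCongr`. [cite: Rogawski1990, §14.5 p. 239; §14.1 p. 232; §1.7 p. 6] [cite: PlatonovRapinchuk1994, §2.3] -/
theorem archCentralValueTransferExists_canonical_of_diagonal
    (hD : ∀ (L : Type) [Field L] [NumberField L] [IsCMField L] (H₂ : Matrix (Fin 3) (Fin 3) L),
  (∃ α : Fin 3 → L, H₂ = Matrix.diagonal α) → ∀ (T : ArchTransferFactor L H₂)
  [MeasurableSpace (UnitaryGroup.arch (↥(maximalRealSubfield L)) L (IsCMField.complexConj L) 3 H₂)]
  [BorelSpace (UnitaryGroup.arch (↥(maximalRealSubfield L)) L (IsCMField.complexConj L) 3 H₂)]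
  [MeasurableSpace (UnitaryGroup.arch (↥(maximalRealSubfield L)) L (IsCMField.complexConj L) 3
    (Matrix.of fun i j : Fin 3 => if i.val + j.val + 1 = 3 then (1 : L) else 0))]
  [BorelSpace (UnitaryGroup.arch (↥(maximalRealSubfield L)) L (IsCMField.complexConj L) 3
    (Matrix.of fun i j : Fin 3 => if i.val + j.val + 1 = 3 then (1 : L) else 0))]
  [MeasurableSpace (UnitaryGroup.arch (↥(maximalRealSubfield L)) L (IsCMField.complexConj L) 2
          (Matrix.of fun i j : Fin 2 => if i.val + j.val + 1 = 2 then (1 : L) else 0) ×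
        UnitaryGroup.arch (↥(maximalRealSubfield L)) L (IsCMField.complexConj L) 1
          (Matrix.of fun i j : Fin 1 => if i.val + j.val + 1 = 1 then (1 : L) else 0))]
  [BorelSpace (UnitaryGroup.arch (↥(maximalRealSubfield L)) L (IsCMField.complexConj L) 2
          (Matrix.of fun i j : Fin 2 => if i.val + j.val + 1 = 2 then (1 : L) else 0) ×
        UnitaryGroup.arch (↥(maximalRealSubfield L)) L (IsCMField.complexConj L) 1
          (Matrix.of fun i j : Fin 1 => if i.val + j.val + 1 = 1 then (1 : L) else 0))]
  (ν' : Measure (UnitaryGroup.arch (↥(maximalRealSubfield L)) L (IsCMField.complexConj L) 3 H₂))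
  (νH : Measure (UnitaryGroup.arch (↥(maximalRealSubfield L)) L (IsCMField.complexConj L) 2
          (Matrix.of fun i j : Fin 2 => if i.val + j.val + 1 = 2 then (1 : L) else 0) ×
        UnitaryGroup.arch (↥(maximalRealSubfield L)) L (IsCMField.complexConj L) 1
          (Matrix.of fun i j : Fin 1 => if i.val + j.val + 1 = 1 then (1 : L) else 0)))
  [ν'.IsHaarMeasure] [ν'.IsMulRightInvariant]
  [νH.IsHaarMeasure] [νH.IsMulRightInvariant],
    (H₂.map (cmConjRingHom L)).transpose = H₂ → (∀ x : Fin 3 → L, hermForm (cmConjRingHom L) H₂ x x = 0 → x = 0) →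
    (∃ w : {w : InfinitePlace L // IsComplex w}, (H₂.map w.1.embedding).PosDef ∨ (-H₂.map w.1.embedding).PosDef) → IsArchNondegenerate L H₂ T →
    ArchCentralValueTransferExists L H₂ T ν' νH) :
    ∀ (L : Type) [Field L] [NumberField L] [IsCMField L] (H' : Matrix (Fin 3) (Fin 3) L) (T : ArchTransferFactor L H')
  [MeasurableSpace (UnitaryGroup.arch (↥(maximalRealSubfield L)) L (IsCMField.complexConj L) 3 H')]
  [BorelSpace (UnitaryGroup.arch (↥(maximalRealSubfield L)) L (IsCMField.complexConj L) 3 H')]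
  [MeasurableSpace (UnitaryGroup.arch (↥(maximalRealSubfield L)) L (IsCMField.complexConj L) 3
    (Matrix.of fun i j : Fin 3 => if i.val + j.val + 1 = 3 then (1 : L) else 0))]
  [BorelSpace (UnitaryGroup.arch (↥(maximalRealSubfield L)) L (IsCMField.complexConj L) 3
    (Matrix.of fun i j : Fin 3 => if i.val + j.val + 1 = 3 then (1 : L) else 0))]
  [MeasurableSpace (UnitaryGroup.arch (↥(maximalRealSubfield L)) L (IsCMField.complexConj L) 2
          (Matrix.of fun i j : Fin 2 => if i.val + j.val + 1 = 2 then (1 : L) else 0) ×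
        UnitaryGroup.arch (↥(maximalRealSubfield L)) L (IsCMField.complexConj L) 1
          (Matrix.of fun i j : Fin 1 => if i.val + j.val + 1 = 1 then (1 : L) else 0))]
  [BorelSpace (UnitaryGroup.arch (↥(maximalRealSubfield L)) L (IsCMField.complexConj L) 2
          (Matrix.of fun i j : Fin 2 => if i.val + j.val + 1 = 2 then (1 : L) else 0) ×
        UnitaryGroup.arch (↥(maximalRealSubfield L)) L (IsCMField.complexConj L) 1
          (Matrix.of fun i j : Fin 1 => if i.val + j.val + 1 = 1 then (1 : L) else 0))]
  (ν' : Measure (UnitaryGroup.arch (↥(maximalRealSubfield L)) L (IsCMField.complexConj L) 3 H'))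
  (νH : Measure (UnitaryGroup.arch (↥(maximalRealSubfield L)) L (IsCMField.complexConj L) 2
          (Matrix.of fun i j : Fin 2 => if i.val + j.val + 1 = 2 then (1 : L) else 0) ×
        UnitaryGroup.arch (↥(maximalRealSubfield L)) L (IsCMField.complexConj L) 1
          (Matrix.of fun i j : Fin 1 => if i.val + j.val + 1 = 1 then (1 : L) else 0)))
  [ν'.IsHaarMeasure] [ν'.IsMulRightInvariant]
  [νH.IsHaarMeasure] [νH.IsMulRightInvariant],
    (H'.map (cmConjRingHom L)).transpose = H' → (∀ x : Fin 3 → L, hermForm (cmConjRingHom L) H' x x = 0 → x = 0) →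
    (∃ w : {w : InfinitePlace L // IsComplex w}, (H'.map w.1.embedding).PosDef ∨ (-H'.map w.1.embedding).PosDef) → IsArchNondegenerate L H' T →
    ArchCentralValueTransferExists L H' T ν' νH := by
  intro L _ _ _ H' T _ _ _ _ _ _ ν' νH _ _ _ _ hherm hanis hS₀ hnd
  -- a rational diagonalising frame
  obtain ⟨P, α, hP⟩ := exists_formCongr_eq_diagonal L H' hherm hanis
  -- the arch congruence `Φ : U(H′)(L ⊗ ℝ) ≃ₜ* U(ᵗc̄P H′ P)(L ⊗ ℝ)` (inverse of ★ the generic congruence iso) and its abstract frame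
  let Ψ : UnitaryGroup.arch (↥(maximalRealSubfield L)) L (IsCMField.complexConj L) 3 (formCongr (cmConjRingHom L) P H') ≃ₜ* UnitaryGroup.arch (↥(maximalRealSubfield L)) L (IsCMField.complexConj L) 3 H' :=
    unitaryGroupOfFormCongrOfEq (UnitaryGroup.conjMixed (↥(maximalRealSubfield L)) L (IsCMField.complexConj L))
      (Matrix.GeneralLinearGroup.map (mixedEmbedding L) P) (UnitaryGroup.archFormOf L 3 H') _ (UnitaryGroup.archFormOf_formCongr L P H').symm
  have hΦ : ∀ g : UnitaryGroup.arch (↥(maximalRealSubfield L)) L (IsCMField.complexConj L) 3 H',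
      ((Ψ.symm g : UnitaryGroup.arch (↥(maximalRealSubfield L)) L (IsCMField.complexConj L) 3 (formCongr (cmConjRingHom L) P H')) : GL (Fin 3) (mixedSpace L)) =
        (Matrix.GeneralLinearGroup.map (mixedEmbedding L) P)⁻¹ * (g : GL (Fin 3) (mixedSpace L)) * (Matrix.GeneralLinearGroup.map (mixedEmbedding L) P)⁻¹⁻¹ :=
    fun g => by rw [inv_inv]; exact UnitaryGroup.coe_archCongr_symm_apply L P H' g
  -- σ-algebras and the pushed Haar measure on the diagonal group
  letI : MeasurableSpace (UnitaryGroup.arch (↥(maximalRealSubfield L)) L (IsCMField.complexConj L) 3 (formCongr (cmConjRingHom L) P H')) := borel _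
  haveI : BorelSpace (UnitaryGroup.arch (↥(maximalRealSubfield L)) L (IsCMField.complexConj L) 3 (formCongr (cmConjRingHom L) P H')) := ⟨rfl⟩
  haveI h1 : (ν'.map Ψ.symm).IsHaarMeasure := ContinuousMulEquiv.isHaarMeasure_map ν' Ψ.symm
  haveI h2 : (ν'.map Ψ.symm).IsMulRightInvariant := isMulRightInvariant_map_mulEquiv_of_isMulRightInvariant Ψ.symm.toMulEquiv Ψ.symm.continuous.measurable ν'
  -- the guards transport along `P`
  have hherm₂ := UnitaryGroup.transpose_map_formCongr_cm L P hherm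
  have hanis₂ := UnitaryGroup.anisotropic_formCongr_cm L P hanis
  have hS₀₂ := UnitaryGroup.exists_posDef_formCongr_cm L P hS₀
  have hTT : (T.comap Ψ.symm.symm.toMulEquiv (fun γH b hb => (isArchNormPair_archCongr_symm_iff L _ Ψ.symm hΦ γH b).1 hb)).comap Ψ.symm.toMulEquiv
      (isArchNormPair_of_archCongr L _ Ψ.symm hΦ) = T :=
    TransferFactorData.comap_symm_comap T Ψ.symm.toMulEquiv _ _
  have hnd₂ : IsArchNondegenerate L (formCongr (cmConjRingHom L) P H')
      (T.comap Ψ.symm.symm.toMulEquiv (fun γH b hb => (isArchNormPair_archCongr_symm_iff L _ Ψ.symm hΦ γH b).1 hb)) := by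
    refine (isArchNondegenerate_comap_iff L _ Ψ.symm hΦ _).1 ?_
    rw [hTT]
    exact hnd
  -- the letter on the diagonal form, carried back along `Φ`
  exact archCentralValueTransferExists_of_archCongr L _ Ψ.symm hΦ T ν' (ν'.map Ψ.symm) rfl νH hherm₂ hanis₂ hS₀₂
    (hD L (formCongr (cmConjRingHom L) P H') ⟨α, hP⟩ _ (ν'.map Ψ.symm) νH hherm₂ hanis₂ hS₀₂ hnd₂)

end Literature.NumberTheory.Rogawski1990

end
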